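/-
Copyright (c) 2026 the pub-hodgecm-mathlib formalisation cell (harness21).  Prover seat hodgecm-mathlib-F0P3-p04 (g12); architect A-p16 (g30) A-130 (2) ∕ A-135 (R1):
the `L_w`-layer of the rider `stub_twoDeepRep_typeTwo` (END fold `LocalTransferAtOneHyperspecialLevelTwo` v3.2 :320), 2026-09-01.
-/
import Literature.NumberTheory.Rogawski1990.TypeTwoNonNormTwistExplicit                           -- ★ p846626 organ (ii-a): the explicit twist `t₋` (generic algebra)
import Literature.NumberTheory.Rogawski1990.StableClassesTypeTwoQuadraticBlock                       -- ★ `exists_nonscalar_hermStar_eq_sq_eq_smul`, `not_isSquare_of_kappa`, …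
import Literature.NumberTheory.LocalFields.UnramifiedQuadraticFixedSquares                           -- ★ `odd_log_valued_of_not_isSquare`
import Literature.NumberTheory.LocalFields.UnramifiedQuadraticNormAtInertPlaceValued                 -- ★ `exists_galAdicCompletionMap_eq_neg_valued_eq_one`
import Literature.NumberTheory.Automorphic.SelfDualLatticeCountFrameTransportCM                      -- ★ `valued_toPlace_uniformizer(_zpow)`, `galAdicCompletionMap_toPlace_self`
import Literature.NumberTheory.Automorphic.Liu2021.FinAdelicCheckSurjective                          -- ★ `galAdicCompletionMap_galAdicCompletionMap_self`
import HarnessLib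

/-!
# The `L_w`-layer of the 2-deep type-(2) representatives: the rescaled `⋆`-fixed square-root generator of `L_w[g]` and the levels of the literals `t₊`, `t₋`

Topic `NumberTheory/Rogawski1990`; namespace `Literature.NumberTheory.Rogawski1990`.  THEOREMS ONLY (no `def`, no instance, no notation, no named fact, no `sorry`); kernel lane
`--supports stmt-HodgeConjecture-24833`.  Cell `pub/hodgecm-mathlib`, crux H413; road «S3-tree», LIFT rider (H2D) `stub_twoDeepRep_typeTwo` (END fold v3.2 :320; architect A-p16 (g30)
A-130 (2), A-135 (R1)).  HONEST LABEL: HC_CM is proved only modulo the cell's 2 remaining named inputs (hLiu418 24832, h413 24833) until rung 0 closes; this file is unconditional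
local algebra and pays no letter by itself.

CONTENTS.  §1 (`exists_sqrtGenerator_coords`): at a non-split unramified `w ∣ v` of the CM field `L` with `|2|_w = 1`, for `g ∈ U(Φ₂) ≤ GL₂(L_w)` with rootless `χ_g` there is a
traceless `⋆`-fixed `Π = (p q; r −p) ∈ L_w[g]` with `Π² = D`, **`|D|_w = |ϖ_v|_w`** (`σp = −p`, `σq = q`, `σr = r ≠ 0`), and coordinates `g = φ₀ + φ₁Π` satisfying the unitarity
relations (R1) `σφ₀φ₁ + σφ₁φ₀ = 0`, (R2) `σφ₀φ₀ + D·σφ₁φ₁ = 1` — `Π = ϖ_v^{m+1}·κ` for the `⋆`-fixed generator `κ = α₀ + β₀g`, `κ² = k₀` (★ `exists_nonscalar_hermStar_eq_sq_eq_smul`),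
`k₀` a `σ_w`-fixed NON-square (★ `not_isSquare_of_kappa`) hence of ODD order `2m+1` (★ `odd_log_valued_of_not_isSquare` — the ramification of `K₁⁺ = L⁺_v(√D)` over `L⁺_v`).
§2 (any `ℤᵐ⁰`-valued field): if `g` is 3-deep (`|g − 1| ≤ |ϖ³|` entrywise) then `|φ₀ − 1|, |φ₁| ≤ |ϖ³|` (`φ₁²D = (φ₁p)² + (φ₁q)(φ₁r)`, orders are integers), so the literal `t₋` of
★ `TypeTwoNonNormTwistExplicit` and the pattern `t₊ = ι(g, u)` are `≡ 1 (mod ϖ²)` and integral, and levels pass through an integral frame `T⁻¹(·)T`.  The sequel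
★ `TwoDeepRepresentativesTypeTwo` assembles the rider in `G′_v`.

## References
* [Rogawski1990] J. D. Rogawski, *Automorphic Representations of Unitary Groups in Three Variables*, Ann. of Math. Stud. 123 (1990), §3.5 Prop. 3.5.2 (a)(c) p. 29, §3.6 p. 31,
  §4.9 p. 55, §14.2 p. 233.
* [Serre1979] J.-P. Serre, *Local Fields* (1979), Ch. II §1, Ch. XIV §4.
* [Flicker1998UnitaryFL] Y. Z. Flicker, *Elementary proof of the fundamental lemma for a unitary group*, Canad. J. Math. 50 (1998), §6 p. 97.
-/

set_option autoImplicit false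

noncomputable section

open NumberField IsDedekindDomain Matrix
open Literature.NumberTheory.Automorphic Literature.NumberTheory.Automorphic.UnitaryGroup
open Literature.NumberTheory.GaloisRepresentations
open Literature.NumberTheory.LocalFields.UnramifiedQuadraticNorm
open scoped MatrixGroups

namespace Literature.NumberTheory.Rogawski1990

section Setup

variable (L : Type) [Field L] [NumberField L] [IsCMField L] {v : HeightOneSpectrum (𝓞 ↥(maximalRealSubfield L))}
  (w : PlacesOver L v) (hw : IsCMField.complexConj L • w.1 = w.1)

/-! ## §1 The rescaled `⋆`-fixed square-root generator `Π = (p q; r −p)` of `L_w[g]` with `|Π²| = |ϖ_v|`, and the coordinates `g = φ₀ + φ₁Π` -/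

/-- `Φ₂ = antidiag(1,1)` over `L_w` as a literal. [cite: Rogawski1990, §4.8 Case (a) p. 53] -/
theorem stdForm_antidiagonal_two_over_eq (K : Type*) [Field K] : (StdForm.antidiagonal 2).over K = !![(0 : K), 1; 1, 0] := by
  ext i j; fin_cases i <;> fin_cases j <;> simp [StdForm.over, StdForm.antidiagonal_J_apply]

/-- `Φ₃ = antidiag(1,1,1)` over `L_w` as a literal. [cite: Rogawski1990, §4.8 Case (a) p. 53] -/
theorem stdForm_antidiagonal_three_over_eq (K : Type*) [Field K] : (StdForm.antidiagonal 3).over K = !![(0 : K), 0, 1; 0, 1, 0; 1, 0, 0] := by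
  ext i j; fin_cases i <;> fin_cases j <;> simp [StdForm.over, StdForm.antidiagonal_J_apply]

/-- Coordinates in `⟨1, Π⟩`: `g = −(α₀∕β₀)·1 + (β₀c)⁻¹·Π` for `Π = c·(α₀ + β₀ g)` (`β₀, c ≠ 0`). [cite: Rogawski1990, §3.6 p. 31] -/
theorem eq_smul_one_add_smul_rescaled_kappa {K : Type*} [Field K] {α₀ β₀ c : K} (hβ₀ : β₀ ≠ 0) (hc : c ≠ 0) (g : Matrix (Fin 2) (Fin 2) K) :
    g = (-(α₀ * β₀⁻¹)) • (1 : Matrix (Fin 2) (Fin 2) K) + (β₀⁻¹ * c⁻¹) • (c • (α₀ • (1 : Matrix (Fin 2) (Fin 2) K) + β₀ • g)) := by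
  have h1 : β₀⁻¹ * c⁻¹ * c * α₀ = α₀ * β₀⁻¹ := by field_simp
  have h2 : β₀⁻¹ * c⁻¹ * c * β₀ = 1 := by field_simp
  rw [smul_smul, smul_add, smul_smul, smul_smul, h1, h2, one_smul]
  module

/-- The literal of `φ₀·1 + φ₁·Π` for `Π = (p q; r −p)`. [cite: Rogawski1990, §3.6 p. 31] -/
theorem smul_one_add_smul_eq_literal {K : Type*} [Field K] (φ₀ φ₁ : K) {P : Matrix (Fin 2) (Fin 2) K} (h11 : P 1 1 = -P 0 0) :
    φ₀ • (1 : Matrix (Fin 2) (Fin 2) K) + φ₁ • P = !![φ₀ + φ₁ * P 0 0, φ₁ * P 0 1; φ₁ * P 1 0, φ₀ - φ₁ * P 0 0] := by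
  ext i j
  fin_cases i <;> fin_cases j <;> simp [h11, mul_neg, sub_eq_add_neg]

include hw in
/-- **THE RESCALED SQUARE-ROOT GENERATOR AND THE COORDINATES OF `g`.**  At a non-split unramified `w ∣ v` with `|2|_w = 1`, for `g ∈ U(Φ₂)(L⁺_v) ≤ GL₂(L_w)` with rootless `χ_g`
there are `p q r D φ₀ φ₁ ∈ L_w` with `σp = −p`, `σq = q`, `σr = r`, `σD = D`, `p² + qr = D`, `r ≠ 0`, **`|D|_w = |ϖ_v|_w`**, `g = (φ₀+φ₁p, φ₁q; φ₁r, φ₀−φ₁p)` and the unitarity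
relations (R1) `σφ₀φ₁ + σφ₁φ₀ = 0`, (R2) `σφ₀φ₀ + D·σφ₁φ₁ = 1`.  (`Π = ϖ_v^{m+1}·κ` for the `⋆`-fixed `κ = α₀ + β₀g`, `κ² = k₀`, ★ `exists_nonscalar_hermStar_eq_sq_eq_smul`; `k₀` is a
`σ`-fixed NON-square ★ `not_isSquare_of_kappa`, hence of ODD order `2m+1` ★ `odd_log_valued_of_not_isSquare`; `r = 0` would make `D = p²` a square.)
[cite: Rogawski1990, §3.6 p. 31; §3.5 Prop. 3.5.2 (a) p. 29] [cite: Serre1979, Ch. XIV §4] -/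
theorem exists_sqrtGenerator_coords (hunr : Algebra.IsUnramifiedIn (𝓞 L) v.asIdeal) (h2 : Valued.v (2 : w.1.adicCompletion L) = 1)
    (g : Matrix (Fin 2) (Fin 2) (w.1.adicCompletion L))
    (hgu : (g.map (galAdicCompletionMap (L := L) (IsCMField.complexConj L) hw))ᵀ * !![(0 : w.1.adicCompletion L), 1; 1, 0] * g =
      !![(0 : w.1.adicCompletion L), 1; 1, 0])
    (hA : ∀ x : w.1.adicCompletion L, g.charpoly.eval x ≠ 0) :
    ∃ p q r D φ₀ φ₁ : w.1.adicCompletion L,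
      galAdicCompletionMap (L := L) (IsCMField.complexConj L) hw p = -p ∧ galAdicCompletionMap (L := L) (IsCMField.complexConj L) hw q = q ∧
      galAdicCompletionMap (L := L) (IsCMField.complexConj L) hw r = r ∧ galAdicCompletionMap (L := L) (IsCMField.complexConj L) hw D = D ∧
      p * p + q * r = D ∧ r ≠ 0 ∧
      Valued.v D = Valued.v (toPlace v w (HeckeCharacter.uniformizer ↥(maximalRealSubfield L) v : v.adicCompletion ↥(maximalRealSubfield L))) ∧
      g = !![φ₀ + φ₁ * p, φ₁ * q; φ₁ * r, φ₀ - φ₁ * p] ∧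
      galAdicCompletionMap (L := L) (IsCMField.complexConj L) hw φ₀ * φ₁ + galAdicCompletionMap (L := L) (IsCMField.complexConj L) hw φ₁ * φ₀ = 0 ∧
      galAdicCompletionMap (L := L) (IsCMField.complexConj L) hw φ₀ * φ₀ + D * (galAdicCompletionMap (L := L) (IsCMField.complexConj L) hw φ₁ * φ₁) = 1 := by
  set σ := galAdicCompletionMap (L := L) (IsCMField.complexConj L) hw with hσdef
  set ϖ : w.1.adicCompletion L := toPlace v w (HeckeCharacter.uniformizer ↥(maximalRealSubfield L) v : v.adicCompletion ↥(maximalRealSubfield L)) with hϖdef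
  have hcc : IsCMField.complexConj L * IsCMField.complexConj L = 1 := AlgEquiv.ext fun y => IsCMField.complexConj_apply_apply L y
  have hσσ : ∀ x, σ (σ x) = x := fun x =>
    Liu2021.galAdicCompletionMap_galAdicCompletionMap_self (↥(maximalRealSubfield L)) L (IsCMField.complexConj L) hcc hw x
  have hϖ0 : ϖ ≠ 0 := toPlace_uniformizer_ne_zero L v w hunr
  have hσϖ : σ ϖ = ϖ := galAdicCompletionMap_toPlace_self L v w hw _
  have h20 : (2 : w.1.adicCompletion L) ≠ 0 := fun h0 => by rw [h0, map_zero] at h2; exact zero_ne_one h2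
  -- a skew unit `δ`
  obtain ⟨δ, hσδ, hvδ⟩ := exists_galAdicCompletionMap_eq_neg_valued_eq_one (IsCMField.complexConj L) v (IsCMField.complexConj_ne_one L) hcc hunr w hw
  have hδ0 : δ ≠ 0 := fun h0 => by rw [h0, map_zero] at hvδ; exact zero_ne_one hvδ
  -- the `⋆`-fixed square-root generator `κ` of `L_w[g]`
  have hGh : ((!![(0 : w.1.adicCompletion L), 1; 1, 0] : Matrix (Fin 2) (Fin 2) (w.1.adicCompletion L)).map σ)ᵀ = !![(0 : w.1.adicCompletion L), 1; 1, 0] := by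
    ext i j; fin_cases i <;> fin_cases j <;> simp
  have hGd : ((!![(0 : w.1.adicCompletion L), 1; 1, 0] : Matrix (Fin 2) (Fin 2) (w.1.adicCompletion L))).det = -1 := by
    simp [Matrix.det_fin_two]
  have hG : IsUnit ((!![(0 : w.1.adicCompletion L), 1; 1, 0] : Matrix (Fin 2) (Fin 2) (w.1.adicCompletion L))).det := by
    rw [hGd]; exact isUnit_one.neg
  obtain ⟨α₀, β₀, k₀, hβ₀, hκs, hsq, hk₀σ⟩ := exists_nonscalar_hermStar_eq_sq_eq_smul σ !![(0 : w.1.adicCompletion L), 1; 1, 0] hσσ hGh hG h20 hσδ hδ0 hA hgu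
  set κ : Matrix (Fin 2) (Fin 2) (w.1.adicCompletion L) := α₀ • (1 : Matrix (Fin 2) (Fin 2) (w.1.adicCompletion L)) + β₀ • g with hκdef
  have hκns : ∀ t : w.1.adicCompletion L, κ ≠ t • 1 := kappa_ne_smul_one hκdef hβ₀ (ne_smul_one_of_eval_charpoly_ne_zero hA)
  obtain ⟨htr, -⟩ := trace_eq_zero_and_det_eq_of_sq hsq hκns
  have hns : ¬ IsSquare k₀ := not_isSquare_of_kappa hA hκdef hβ₀ hsq
  have hk₀0 : k₀ ≠ 0 := fun h0 => hns ⟨0, by rw [h0, mul_zero]⟩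
  -- `k₀` has odd order `2m+1`; rescale by `c = ϖ^{m+1}`
  obtain ⟨m, hm⟩ := odd_log_valued_of_not_isSquare L v w hw hunr h2 hk₀σ hns
  set c : w.1.adicCompletion L := ϖ ^ (m + 1) with hcdef
  have hc0 : c ≠ 0 := zpow_ne_zero _ hϖ0
  have hσc : σ c = c := by rw [hcdef, map_zpow₀, hσϖ]
  have hvc : Valued.v c = WithZero.exp (-(m + 1)) := by rw [hcdef]; exact valued_toPlace_uniformizer_zpow L v w hunr (m + 1)
  have hv0 : Valued.v k₀ ≠ 0 := (Valuation.ne_zero_iff _).2 hk₀0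
  have hvk₀ : Valued.v k₀ = WithZero.exp (2 * m + 1) := by
    rw [← hm, WithZero.exp_log hv0]
  set D : w.1.adicCompletion L := c * c * k₀ with hDdef
  have hσD : σ D = D := by rw [hDdef, map_mul, map_mul, hσc, hk₀σ]
  have hvD : Valued.v D = Valued.v ϖ := by
    rw [hDdef, map_mul, map_mul, hvc, hvk₀, valued_toPlace_uniformizer L v w hunr, ← WithZero.exp_add, ← WithZero.exp_add]
    congr 1; ring
  -- `Π = c • κ`: traceless, `⋆`-fixed, `Π² = D`
  set P : Matrix (Fin 2) (Fin 2) (w.1.adicCompletion L) := c • κ with hPdef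
  have hPtr : P.trace = 0 := by rw [hPdef, Matrix.trace_smul, htr, smul_zero]
  have hPsq : P * P = D • (1 : Matrix (Fin 2) (Fin 2) (w.1.adicCompletion L)) := by
    rw [hPdef, smul_mul_smul_comm, hsq, smul_smul, hDdef]
  have hPs' : hermStar σ !![(0 : w.1.adicCompletion L), 1; 1, 0] P = P := by
    rw [hPdef, hermStar_smul, hκs, hσc]
  have hPs : (P.map σ)ᵀ * !![(0 : w.1.adicCompletion L), 1; 1, 0] = !![(0 : w.1.adicCompletion L), 1; 1, 0] * P := by
    have h := congrArg (fun M => !![(0 : w.1.adicCompletion L), 1; 1, 0] * M) hPs'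
    simp only [hermStar_def, ← Matrix.mul_assoc] at h
    rwa [Matrix.mul_nonsing_inv _ hG, Matrix.one_mul] at h
  obtain ⟨hp, hq, hr, h11, hDsum⟩ := sqrtGenerator_shape σ P hPs hPtr hPsq
  -- coordinates of `g` in `⟨1, Π⟩`
  set φ₀ : w.1.adicCompletion L := -(α₀ * β₀⁻¹) with hφ₀def
  set φ₁ : w.1.adicCompletion L := β₀⁻¹ * c⁻¹ with hφ₁def
  have hgφ : g = φ₀ • (1 : Matrix (Fin 2) (Fin 2) (w.1.adicCompletion L)) + φ₁ • P := by
    rw [hPdef, hκdef, hφ₀def, hφ₁def]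
    exact eq_smul_one_add_smul_rescaled_kappa hβ₀ hc0 g
  have hglit : g = !![φ₀ + φ₁ * P 0 0, φ₁ * P 0 1; φ₁ * P 1 0, φ₀ - φ₁ * P 0 0] := by
    rw [hgφ]
    exact smul_one_add_smul_eq_literal φ₀ φ₁ h11
  have hr0 : P 1 0 ≠ 0 := by
    intro h0
    apply hns
    -- `D = p²` so `k₀ = (p / c)²`
    have hDp : D = P 0 0 * P 0 0 := by rw [← hDsum, h0, mul_zero, add_zero]
    refine ⟨P 0 0 * c⁻¹, ?_⟩
    have : k₀ = D * (c⁻¹ * c⁻¹) := by rw [hDdef]; field_simp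
    rw [this, hDp]; ring
  have hgu' := hgu
  rw [hglit] at hgu'
  obtain ⟨R1, R2⟩ := typeTwo_relations_of_unitary σ hp hr hDsum hr0 hgu'
  exact ⟨P 0 0, P 0 1, P 1 0, D, φ₀, φ₁, hp, hq, hr, hσD, hDsum, hr0, hvD, hglit, R1, R2⟩


/-! ## §2 Valuations (any `ℤᵐ⁰`-valued field): 3-deep `g` ⇒ `|φ₀ − 1|, |φ₁| ≤ |ϖ³|` ⇒ the literals `t₊`, `t₋` are integral and `≡ 1 (mod ϖ²)` -/

section Valued

variable {K : Type*} [Field K] [hK : Valued K (WithZero (Multiplicative ℤ))]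

/-- In a `ℤᵐ⁰`-valued field: `|x|²·exp(−1) ≤ exp(−6)` forces `|x| ≤ exp(−3)` (orders are integers). [cite: Serre1979, Ch. II §1] -/
theorem valued_le_exp_neg_three_of_sq (x : K) (h : Valued.v x * Valued.v x * WithZero.exp (-1 : ℤ) ≤ WithZero.exp (-6 : ℤ)) :
    Valued.v x ≤ WithZero.exp (-3 : ℤ) := by
  by_cases hx : x = 0
  · rw [hx, map_zero]; exact zero_le
  · have hv0 : Valued.v x ≠ 0 := (Valuation.ne_zero_iff _).2 hx
    set n : ℤ := WithZero.log (Valued.v x) with hn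
    have hvx : Valued.v x = WithZero.exp n := by rw [hn, WithZero.exp_log hv0]
    rw [hvx, ← WithZero.exp_add, ← WithZero.exp_add, WithZero.exp_le_exp] at h
    rw [hvx, WithZero.exp_le_exp]
    omega

/-- **3-deep `g` ⇒ `|φ₀ − 1| ≤ |ϖ³|` and `|φ₁| ≤ |ϖ³|`** for `g = (φ₀+φ₁p, φ₁q; φ₁r, φ₀−φ₁p)` with `p² + qr = D`, `|D| = |ϖ| = exp(−1)`, `|2| = 1`
(`φ₀ − 1 = ½(tr g − 2)`, `φ₁²D = (φ₁p)² + (φ₁q)(φ₁r)`). [cite: Serre1979, Ch. II §1] [cite: Rogawski1990, §3.6 p. 31] -/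
theorem valued_coords_of_entrywise_deep {p q r D φ₀ φ₁ ϖ : K} (hD : p * p + q * r = D) (hvD : Valued.v D = Valued.v ϖ)
    (hvϖ : Valued.v ϖ = WithZero.exp (-1 : ℤ)) (h2 : Valued.v (2 : K) = 1)
    (hg : ∀ i j, Valued.v (((!![φ₀ + φ₁ * p, φ₁ * q; φ₁ * r, φ₀ - φ₁ * p] : Matrix (Fin 2) (Fin 2) K) - 1) i j) ≤ Valued.v (ϖ ^ 3)) :
    Valued.v (φ₀ - 1) ≤ Valued.v (ϖ ^ 3) ∧ Valued.v φ₁ ≤ Valued.v (ϖ ^ 3) := by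
  have h20 : (2 : K) ≠ 0 := fun h0 => by rw [h0, map_zero] at h2; exact zero_ne_one h2
  have hv2i : Valued.v (2⁻¹ : K) = 1 := by rw [map_inv₀, h2, inv_one]
  have e00 : Valued.v (φ₀ + φ₁ * p - 1) ≤ Valued.v (ϖ ^ 3) := by
    have h := hg 0 0; rwa [Matrix.sub_apply, Matrix.one_apply_eq] at h
  have e11 : Valued.v (φ₀ - φ₁ * p - 1) ≤ Valued.v (ϖ ^ 3) := by
    have h := hg 1 1; rwa [Matrix.sub_apply, Matrix.one_apply_eq] at h
  have e01 : Valued.v (φ₁ * q) ≤ Valued.v (ϖ ^ 3) := by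
    have h := hg 0 1; rwa [Matrix.sub_apply, Matrix.one_apply_ne (by decide), sub_zero] at h
  have e10 : Valued.v (φ₁ * r) ≤ Valued.v (ϖ ^ 3) := by
    have h := hg 1 0; rwa [Matrix.sub_apply, Matrix.one_apply_ne (by decide), sub_zero] at h
  have hφ₀ : Valued.v (φ₀ - 1) ≤ Valued.v (ϖ ^ 3) := by
    have e : φ₀ - 1 = 2⁻¹ * ((φ₀ + φ₁ * p - 1) + (φ₀ - φ₁ * p - 1)) := by
      field_simp
      ring
    rw [e, map_mul, hv2i, one_mul]
    exact (Valuation.map_add _ _ _).trans (max_le e00 e11)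
  have hφ₁p : Valued.v (φ₁ * p) ≤ Valued.v (ϖ ^ 3) := by
    have e : φ₁ * p = 2⁻¹ * ((φ₀ + φ₁ * p - 1) - (φ₀ - φ₁ * p - 1)) := by
      field_simp
      ring
    rw [e, map_mul, hv2i, one_mul]
    exact (Valuation.map_sub _ _ _).trans (max_le e00 e11)
  have hϖ3 : Valued.v (ϖ ^ 3) = WithZero.exp (-3 : ℤ) := by
    rw [map_pow, hvϖ, ← WithZero.exp_nsmul]; norm_num
  refine ⟨hφ₀, ?_⟩
  rw [hϖ3]
  refine valued_le_exp_neg_three_of_sq φ₁ ?_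
  have e : φ₁ * φ₁ * D = φ₁ * p * (φ₁ * p) + φ₁ * q * (φ₁ * r) := by rw [← hD]; ring
  have h6 : Valued.v (φ₁ * φ₁ * D) ≤ WithZero.exp (-6 : ℤ) := by
    have e6 : WithZero.exp (-6 : ℤ) = WithZero.exp (-3 : ℤ) * WithZero.exp (-3 : ℤ) := by rw [← WithZero.exp_add]; norm_num
    rw [e, e6]
    refine (Valuation.map_add _ _ _).trans (max_le ?_ ?_)
    · rw [map_mul]; exact mul_le_mul' (hφ₁p.trans_eq hϖ3) (hφ₁p.trans_eq hϖ3)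
    · rw [map_mul]; exact mul_le_mul' (e01.trans_eq hϖ3) (e10.trans_eq hϖ3)
  rwa [map_mul, map_mul, hvD, hvϖ] at h6

/-- **The literal `t₋` is `≡ 1 (mod ϖ²)`**: with `|φ₀ − 1|, |φ₁|, |u − 1| ≤ |ϖ³|`, `|D| = |ϖ| = exp(−1)`, `|2| = 1`, every entry of `t₋ − 1` has valuation `≤ |ϖ²|`
(the entry `(φ₀ − u)∕4D` loses exactly one level). [cite: Serre1979, Ch. II §1] [cite: Rogawski1990, §4.9 p. 55] -/
theorem valued_twistRep_sub_one_le {D φ₀ φ₁ u ϖ : K} (hvD : Valued.v D = Valued.v ϖ) (hvϖ : Valued.v ϖ = WithZero.exp (-1 : ℤ)) (h2 : Valued.v (2 : K) = 1)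
    (hφ₀ : Valued.v (φ₀ - 1) ≤ Valued.v (ϖ ^ 3)) (hφ₁ : Valued.v φ₁ ≤ Valued.v (ϖ ^ 3)) (hu : Valued.v (u - 1) ≤ Valued.v (ϖ ^ 3)) :
    ∀ a b, Valued.v (((!![(u + φ₀) * 2⁻¹, φ₁ * 2⁻¹, (φ₀ - u) * 2⁻¹ * 2⁻¹ * D⁻¹; φ₁ * D, φ₀, φ₁ * 2⁻¹; D * (φ₀ - u), D * φ₁, (u + φ₀) * 2⁻¹] :
      Matrix (Fin 3) (Fin 3) K) - 1) a b) ≤ Valued.v (ϖ ^ 2) := by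
  have h20 : (2 : K) ≠ 0 := fun h0 => by rw [h0, map_zero] at h2; exact zero_ne_one h2
  have hv2i : Valued.v (2⁻¹ : K) = 1 := by rw [map_inv₀, h2, inv_one]
  have hϖ0 : ϖ ≠ 0 := fun h0 => by rw [h0, map_zero] at hvϖ; exact WithZero.zero_ne_coe hvϖ
  have hD0 : D ≠ 0 := fun h0 => by rw [h0, map_zero, hvϖ] at hvD; exact WithZero.zero_ne_coe hvD
  have hϖ3 : Valued.v (ϖ ^ 3) = WithZero.exp (-3 : ℤ) := by rw [map_pow, hvϖ, ← WithZero.exp_nsmul]; norm_num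
  have hϖ2 : Valued.v (ϖ ^ 2) = WithZero.exp (-2 : ℤ) := by rw [map_pow, hvϖ, ← WithZero.exp_nsmul]; norm_num
  have h32 : Valued.v (ϖ ^ 3) ≤ Valued.v (ϖ ^ 2) := by rw [hϖ3, hϖ2, WithZero.exp_le_exp]; norm_num
  have hDle : Valued.v D ≤ 1 := by rw [hvD, hvϖ, ← WithZero.exp_zero, WithZero.exp_le_exp]; norm_num
  have hφu : Valued.v (φ₀ - u) ≤ Valued.v (ϖ ^ 3) := by
    have e : φ₀ - u = (φ₀ - 1) - (u - 1) := by ring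
    rw [e]; exact (Valuation.map_sub _ _ _).trans (max_le hφ₀ hu)
  -- the four shapes of entries
  have hdiag : Valued.v ((u + φ₀) * 2⁻¹ - 1) ≤ Valued.v (ϖ ^ 2) := by
    have e : (u + φ₀) * 2⁻¹ - 1 = 2⁻¹ * ((u - 1) + (φ₀ - 1)) := by field_simp; ring
    rw [e, map_mul, hv2i, one_mul]
    exact ((Valuation.map_add _ _ _).trans (max_le hu hφ₀)).trans h32
  have hφ₁ι : Valued.v (φ₁ * 2⁻¹) ≤ Valued.v (ϖ ^ 2) := by rw [map_mul, hv2i, mul_one]; exact hφ₁.trans h32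
  have hcorner : Valued.v ((φ₀ - u) * 2⁻¹ * 2⁻¹ * D⁻¹) ≤ Valued.v (ϖ ^ 2) := by
    rw [map_mul, map_mul, map_mul, hv2i, mul_one, mul_one, map_inv₀, hvD, hvϖ, hϖ2]
    calc Valued.v (φ₀ - u) * (WithZero.exp (-1 : ℤ))⁻¹ ≤ WithZero.exp (-3 : ℤ) * (WithZero.exp (-1 : ℤ))⁻¹ :=
          mul_le_mul' (hφu.trans_eq hϖ3) le_rfl
      _ = WithZero.exp (-2 : ℤ) := by rw [← WithZero.exp_neg, ← WithZero.exp_add]; norm_num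
  have hφ₁D : Valued.v (φ₁ * D) ≤ Valued.v (ϖ ^ 2) := by
    rw [map_mul]; exact (mul_le_mul' hφ₁ hDle).trans (by rw [mul_one]; exact h32)
  have hDφ₁ : Valued.v (D * φ₁) ≤ Valued.v (ϖ ^ 2) := by rw [mul_comm]; exact hφ₁D
  have hDφu : Valued.v (D * (φ₀ - u)) ≤ Valued.v (ϖ ^ 2) := by
    rw [map_mul]; exact (mul_le_mul' hDle hφu).trans (by rw [one_mul]; exact h32)
  intro a b
  fin_cases a <;> fin_cases b
  · simpa [Matrix.sub_apply] using hdiag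
  · simpa [Matrix.sub_apply] using hφ₁ι
  · simpa [Matrix.sub_apply] using hcorner
  · simpa [Matrix.sub_apply] using hφ₁D
  · simpa [Matrix.sub_apply] using hφ₀.trans h32
  · simpa [Matrix.sub_apply] using hφ₁ι
  · simpa [Matrix.sub_apply] using hDφu
  · simpa [Matrix.sub_apply] using hDφ₁
  · simpa [Matrix.sub_apply] using hdiag

/-- **The pattern `t₊ = ι(g, u)` is `≡ 1 (mod ϖ²)`** when `g` and `u` are 3-deep. [cite: Serre1979, Ch. II §1] [cite: Rogawski1990, §4.9 p. 55] -/
theorem valued_pattern_sub_one_le {ϖ : K} (hvϖ : Valued.v ϖ = WithZero.exp (-1 : ℤ)) (g : Matrix (Fin 2) (Fin 2) K) (u : K)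
    (hg : ∀ i j, Valued.v ((g - 1) i j) ≤ Valued.v (ϖ ^ 3)) (hu : Valued.v (u - 1) ≤ Valued.v (ϖ ^ 3)) :
    ∀ a b, Valued.v (((!![g 0 0, 0, g 0 1; 0, u, 0; g 1 0, 0, g 1 1] : Matrix (Fin 3) (Fin 3) K) - 1) a b) ≤ Valued.v (ϖ ^ 2) := by
  have hϖ3 : Valued.v (ϖ ^ 3) = WithZero.exp (-3 : ℤ) := by rw [map_pow, hvϖ, ← WithZero.exp_nsmul]; norm_num
  have hϖ2 : Valued.v (ϖ ^ 2) = WithZero.exp (-2 : ℤ) := by rw [map_pow, hvϖ, ← WithZero.exp_nsmul]; norm_num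
  have h32 : Valued.v (ϖ ^ 3) ≤ Valued.v (ϖ ^ 2) := by rw [hϖ3, hϖ2, WithZero.exp_le_exp]; norm_num
  have e00 : Valued.v (g 0 0 - 1) ≤ Valued.v (ϖ ^ 2) := by
    have h := hg 0 0; rw [Matrix.sub_apply, Matrix.one_apply_eq] at h; exact h.trans h32
  have e11 : Valued.v (g 1 1 - 1) ≤ Valued.v (ϖ ^ 2) := by
    have h := hg 1 1; rw [Matrix.sub_apply, Matrix.one_apply_eq] at h; exact h.trans h32
  have e01 : Valued.v (g 0 1) ≤ Valued.v (ϖ ^ 2) := by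
    have h := hg 0 1; rw [Matrix.sub_apply, Matrix.one_apply_ne (by decide), sub_zero] at h; exact h.trans h32
  have e10 : Valued.v (g 1 0) ≤ Valued.v (ϖ ^ 2) := by
    have h := hg 1 0; rw [Matrix.sub_apply, Matrix.one_apply_ne (by decide), sub_zero] at h; exact h.trans h32
  intro a b
  fin_cases a <;> fin_cases b
  · simpa [Matrix.sub_apply] using e00
  · simp [Matrix.sub_apply]
  · simpa [Matrix.sub_apply] using e01
  · simp [Matrix.sub_apply]
  · simpa [Matrix.sub_apply] using hu.trans h32
  · simp [Matrix.sub_apply]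
  · simpa [Matrix.sub_apply] using e10
  · simp [Matrix.sub_apply]
  · simpa [Matrix.sub_apply] using e11

/-- A matrix `≡ 1 (mod ϖ²)` (`|ϖ| = exp(−1)`) is entrywise integral. [cite: Serre1979, Ch. II §1] -/
theorem valued_apply_le_one_of_sub_one_le {ϖ : K} (hvϖ : Valued.v ϖ = WithZero.exp (-1 : ℤ)) {n : ℕ} (M : Matrix (Fin n) (Fin n) K)
    (hM : ∀ a b, Valued.v ((M - 1) a b) ≤ Valued.v (ϖ ^ 2)) : ∀ a b, Valued.v (M a b) ≤ 1 := by
  have hϖ2 : Valued.v (ϖ ^ 2) ≤ 1 := by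
    rw [map_pow, hvϖ, ← WithZero.exp_nsmul, ← WithZero.exp_zero, WithZero.exp_le_exp]; norm_num
  intro a b
  have e : M a b = (M - 1) a b + (1 : Matrix (Fin n) (Fin n) K) a b := by rw [Matrix.sub_apply, sub_add_cancel]
  rw [e]
  refine (Valuation.map_add _ _ _).trans (max_le ((hM a b).trans hϖ2) ?_)
  rcases eq_or_ne a b with rfl | hab
  · rw [Matrix.one_apply_eq, map_one]
  · rw [Matrix.one_apply_ne hab, map_zero]; exact zero_le

/-- **Transport of the level through an integral frame**: if `M ≡ 1 (mod 𝔞)` entrywise (`|(M − 1)_{ab}| ≤ C`) and `T, T⁻¹` are entrywise integral, then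
`T⁻¹ M T ≡ 1 (mod 𝔞)` (`T⁻¹ M T − 1 = T⁻¹ (M − 1) T`, ultrametric inequality). [cite: Serre1979, Ch. II §1] [cite: Rogawski1990, §14.2 p. 233] -/
theorem valued_conj_sub_one_le {n : ℕ} (T : GL (Fin n) K) (hT : ∀ a b, Valued.v ((T : Matrix (Fin n) (Fin n) K) a b) ≤ 1)
    (hTi : ∀ a b, Valued.v (((T⁻¹ : GL (Fin n) K) : Matrix (Fin n) (Fin n) K) a b) ≤ 1) (M : Matrix (Fin n) (Fin n) K) {C : WithZero (Multiplicative ℤ)}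
    (hM : ∀ a b, Valued.v ((M - 1) a b) ≤ C) :
    ∀ a b, Valued.v ((((T⁻¹ : GL (Fin n) K) : Matrix (Fin n) (Fin n) K) * M * (T : Matrix (Fin n) (Fin n) K) - 1) a b) ≤ C := by
  have e : ((T⁻¹ : GL (Fin n) K) : Matrix (Fin n) (Fin n) K) * M * (T : Matrix (Fin n) (Fin n) K) - 1 =
      ((T⁻¹ : GL (Fin n) K) : Matrix (Fin n) (Fin n) K) * (M - 1) * (T : Matrix (Fin n) (Fin n) K) := by
    rw [Matrix.mul_sub, Matrix.sub_mul, Matrix.mul_one, ← Units.val_mul, inv_mul_cancel, Units.val_one]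
  intro a b
  rw [e, Matrix.mul_apply]
  refine Valuation.map_sum_le _ fun k _ => ?_
  rw [map_mul]
  have h1 : Valued.v ((((T⁻¹ : GL (Fin n) K) : Matrix (Fin n) (Fin n) K) * (M - 1)) a k) ≤ C := by
    rw [Matrix.mul_apply]
    refine Valuation.map_sum_le _ fun l _ => ?_
    rw [map_mul]
    calc Valued.v (((T⁻¹ : GL (Fin n) K) : Matrix (Fin n) (Fin n) K) a l) * Valued.v ((M - 1) l k) ≤ 1 * C := mul_le_mul' (hTi a l) (hM l k)
      _ = C := one_mul C
  calc Valued.v ((((T⁻¹ : GL (Fin n) K) : Matrix (Fin n) (Fin n) K) * (M - 1)) a k) * Valued.v ((T : Matrix (Fin n) (Fin n) K) k b) ≤ C * 1 :=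
        mul_le_mul' h1 (hT k b)
    _ = C := mul_one C

end Valued

end Setup

end Literature.NumberTheory.Rogawski1990

end
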